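/-
Copyright (c) 2026. All rights reserved.
Released under Apache 2.0 license as described in the file LICENSE.
Authors: abc-iut cell, seat abc-iut-f-069 (gen 9; row «PL2-FOX», supplement).
-/
import Literature.AnabelianGeometry.EtaleTheta.SettingModelFoxLevelMaps
import Literature.Algebra.Homology.FreeGroupFoxDerivatives
import HarnessLib

/-!
# The level Fox homomorphisms, supplement: on `η(F₂)` the chains ARE the Fox derivatives

Mochizuki, *The étale theta function …*, Publ. RIMS **45** (2009) [EtTh], §1, PRIMS PDF p. 12
[cite: MochizukiEtTh2009, §1 p.12] (the model `F̂₂ ⊃ η(F₂)`); Fox's free differential calculus (Lyndon–Schupp,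
*Combinatorial Group Theory*, Ch. II §3 [cite: LyndonSchupp2001, Ch. II §3]; Brown, *Cohomology of Groups*, II §5
Ex. 3 (b), the tree's `FoxCalculus.foxDeriv` of `Algebra/Homology/FreeGroupFoxDerivatives.lean`, lit-hodgefound p30).

PROOF-ONLY leaf file (no definition, no instance, no notation), abc-iut-f-069 (gen 9), item (vi) of the PL2-FOX key:
for a word `w ∈ F₂ = F(a,b)`, the `a`-chain `α_{η w}` of `SettingModelFoxLevelMaps` at level `(G, A, B)` with
coefficients in `k` is the image of the Fox derivative `∂w/∂a ∈ k[F₂]` under `k[F₂] → k[G] → k^G` (push forward along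
`a ↦ A, b ↦ B`, then read coefficients), and likewise `β_{η w}` is the image of `∂w/∂b` (`alpha_eta_eq_foxDeriv`,
`beta_eta_eq_foxDeriv`; one induction on words: both sides are derivations with the same values on `a`, `b`).  Kept in a
separate leaf so that the consumers of the level Fox maps need not import the representation-theoretic Fox calculus.
Classical; nothing of [EtTh] is asserted; no side is taken on [IUTchIII] Cor. 3.12.
-/

noncomputable section

namespace Literature.AnabelianGeometry.EtaleTheta.SettingModel.FoxLevel

open Literature.GroupTheory.CombinatorialGroupTheory.FoxChain
open Literature.Algebra.Homology (FoxCalculus.foxDeriv FoxCalculus.foxDeriv_mul FoxCalculus.foxDeriv_one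
  FoxCalculus.foxDeriv_of FoxCalculus.foxDeriv_inv)

variable {G : Type} [Group G] [Finite G] [DecidableEq G] {k : Type} [CommRing k] [Finite k]

omit [Finite G] [Finite k] in
/-- The coefficient function of `single 1 1 ∈ k[G]` is the indicator `e_1`. [cite: LyndonSchupp2001, Ch. II §3] -/
private theorem single_one_apply_eq_e (q : G) : (e 1 : G → k) q = Finsupp.single (1 : G) (1 : k) q := by
  rw [Finsupp.single_apply, e]
  by_cases hq : q = 1
  · rw [if_pos hq, if_pos hq.symm]
  · rw [if_neg hq, if_neg (Ne.symm hq)]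

omit [Finite G] [DecidableEq G] [Finite k] in
/-- `mapDomain` commutes with negation. [folklore] -/
private theorem mapDomain_neg (φ : F₂ →* G) (x : MonoidAlgebra k F₂) :
    MonoidAlgebra.mapDomain φ (-x) = -MonoidAlgebra.mapDomain φ x :=
  map_neg (MonoidAlgebra.mapDomainRingHom k φ) x

omit [Finite G] [DecidableEq G] [Finite k] in
/-- Reading coefficients after push-forward turns left multiplication by `u` in `k[F₂]` into the left translation
`λ_{φ u}` of coefficient functions on `G`. [cite: LyndonSchupp2001, Ch. II §3] -/
theorem coeff_mapDomain_of_mul (φ : F₂ →* G) (u : F₂) (x : MonoidAlgebra k F₂) :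
    ⇑(MonoidAlgebra.mapDomain φ (MonoidAlgebra.of k F₂ u * x)).coeff =
      lt (φ u) ⇑(MonoidAlgebra.mapDomain φ x).coeff := by
  funext g
  rw [MonoidAlgebra.mapDomain_mul, MonoidAlgebra.of_apply, MonoidAlgebra.mapDomain_single,
    MonoidAlgebra.coeff_single_mul_apply, one_mul, lt_apply]

/-- **On `η(F₂)` the chains are the Fox derivatives**: for `w ∈ F(a,b)`,
`(α_{η w}, β_{η w}) = (φ_*(∂w/∂a), φ_*(∂w/∂b))` read as coefficient functions on `G` (`φ : a ↦ A, b ↦ B`).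
[cite: LyndonSchupp2001, Ch. II §3] -/
theorem alpha_beta_eta_eq_foxDeriv (A B : G) (w : F₂) :
    alpha (k := k) A B (eta w) =
        ⇑(MonoidAlgebra.mapDomain (FreeGroup.lift ![A, B]) (FoxCalculus.foxDeriv k (Fin 2) 0 w)).coeff ∧
      beta (k := k) A B (eta w) =
        ⇑(MonoidAlgebra.mapDomain (FreeGroup.lift ![A, B]) (FoxCalculus.foxDeriv k (Fin 2) 1 w)).coeff := by
  induction w using FreeGroup.induction_on with
  | C1 =>
    rw [map_one, alpha_one, beta_one, FoxCalculus.foxDeriv_one, FoxCalculus.foxDeriv_one,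
      MonoidAlgebra.mapDomain_zero]
    exact ⟨rfl, rfl⟩
  | of i =>
    fin_cases i
    · simp only [Fin.zero_eta, Fin.isValue]
      rw [alpha_genA, beta_genA]
      simp only [Fin.isValue, FoxCalculus.foxDeriv_of, if_true, MonoidAlgebra.one_def,
        MonoidAlgebra.mapDomain_single, map_one, MonoidAlgebra.coeff_single]
      exact ⟨funext fun q => single_one_apply_eq_e q, rfl⟩
    · simp only [Fin.mk_one, Fin.isValue]
      rw [alpha_genB, beta_genB]
      simp only [Fin.isValue, FoxCalculus.foxDeriv_of, if_true, MonoidAlgebra.one_def,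
        MonoidAlgebra.mapDomain_single, map_one, MonoidAlgebra.coeff_single]
      exact ⟨rfl, funext fun q => single_one_apply_eq_e q⟩
  | inv_of i ih =>
    rw [map_inv, alpha_inv, beta_inv, ih.1, ih.2, lev_eta, FoxCalculus.foxDeriv_inv, FoxCalculus.foxDeriv_inv,
      mapDomain_neg, mapDomain_neg, MonoidAlgebra.coeff_neg, MonoidAlgebra.coeff_neg, Finsupp.coe_neg,
      Finsupp.coe_neg, coeff_mapDomain_of_mul, coeff_mapDomain_of_mul, map_inv]
    exact ⟨rfl, rfl⟩
  | mul x y hx hy =>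
    rw [map_mul, alpha_mul, beta_mul, hx.1, hx.2, hy.1, hy.2, lev_eta, FoxCalculus.foxDeriv_mul,
      FoxCalculus.foxDeriv_mul, MonoidAlgebra.mapDomain_add, MonoidAlgebra.mapDomain_add, MonoidAlgebra.coeff_add,
      MonoidAlgebra.coeff_add, Finsupp.coe_add, Finsupp.coe_add, coeff_mapDomain_of_mul, coeff_mapDomain_of_mul]
    exact ⟨rfl, rfl⟩

/-- `α_{η w} = φ_*(∂w/∂a)`. [cite: LyndonSchupp2001, Ch. II §3] -/
theorem alpha_eta_eq_foxDeriv (A B : G) (w : F₂) :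
    alpha (k := k) A B (eta w) =
      ⇑(MonoidAlgebra.mapDomain (FreeGroup.lift ![A, B]) (FoxCalculus.foxDeriv k (Fin 2) 0 w)).coeff :=
  (alpha_beta_eta_eq_foxDeriv A B w).1

/-- `β_{η w} = φ_*(∂w/∂b)`. [cite: LyndonSchupp2001, Ch. II §3] -/
theorem beta_eta_eq_foxDeriv (A B : G) (w : F₂) :
    beta (k := k) A B (eta w) =
      ⇑(MonoidAlgebra.mapDomain (FreeGroup.lift ![A, B]) (FoxCalculus.foxDeriv k (Fin 2) 1 w)).coeff :=
  (alpha_beta_eta_eq_foxDeriv A B w).2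

end Literature.AnabelianGeometry.EtaleTheta.SettingModel.FoxLevel

end
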